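import Mathlib
import HarnessLib

/-!
# Viscous gCLM/OSW profile MODEL: calculus of the REGULARISED POWER test function `Φ_δ(s) = (s² + δ)^{p/2} − δ^{p/2}`

HONEST FRAMING (cell ns-blowup GROUP B «PROFILE SEARCH», zone Z3 = the 1-D viscous gCLM/OSW sheet; human rulings
D-0035/D-0074): **elementary one-variable real analysis (no fluid object at all); «violates: none — MODEL bookkeeping».**
Nothing in this file is a statement about Navier–Stokes.

OBJECT. For an exponent `p ≥ 1` and a regularisation parameter `δ > 0`, the smooth convex even function
  `Φ_δ(s) = (s² + δ)^{p/2} − δ^{p/2}`,  `Φ_δ′(s) = p s (s² + δ)^{p/2 − 1}`,  `Φ_δ″(s) = p (s² + δ)^{p/2 − 2}((p − 1)s² + δ)`,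
with `Φ_δ(0) = Φ_δ′(0) = 0`, which replaces the non-smooth `|s|^p` as the test function of `SheetLpTestIdentity.integral_Ioi_test_le`
(the `L^{|a|}` test of `SheetNSLineLpEmpty`). Everything is written with explicit lambdas (no definitions).

WHAT IS KERNEL-CHECKED HERE. (i) the two derivatives (`hasDerivAt_powReg`, `hasDerivAt_dPowReg`), continuity of `Φ_δ″`, the
values at `0`, and the signs `Φ_δ ≥ 0`, `sΦ_δ′(s) ≥ 0`, `Φ_δ″ ≥ 0` (`p ≥ 1`); (ii) the `δ`-UNIFORM LINEAR BOUNDS on a bounded range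
`|s| ≤ S`, `0 < δ ≤ 1`: `Φ_δ(s) ≤ K|s|` and `sΦ_δ′(s) ≤ K|s|` (`powReg_le_linear`, `mul_dPowReg_le_linear`; mean value theorem for
`p ≥ 2`, subadditivity of `x ↦ x^{p/2}` for `p < 2`) — these make `K|Ω|(1 + |HΩ|)` a dominating function; (iii) the limits
`δ → 0⁺`: `Φ_δ(s) → |s|^p`, `sΦ_δ′(s) → p|s|^p` (`tendsto_powReg`, `tendsto_mul_dPowReg`), and `(s²)^{p/2} = |s|^p`.
NOT HERE: any profile, any integral. Standard axioms; no definitions.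
bears_on: LADDER-NS N5 / zone Z3 row Z3-E12⁻ clause (i′) → N1 linear core (helper of the [g14] `L^{|a|}` test).
-/

noncomputable section
open Set Filter Topology

namespace Summit.NavierStokesRegularity.OSWSelfSimilar
namespace SheetHalfLine

/-! ### Algebra of `|s|^p` -/

/-- `(s²)^{p/2} = |s|^p`. [folklore] -/
theorem sq_rpow_half (s p : ℝ) : (s ^ 2) ^ (p / 2) = |s| ^ p := by
  have h : (s ^ 2 : ℝ) = |s| ^ (2:ℝ) := by rw [Real.rpow_two, sq_abs]
  rw [h, ← Real.rpow_mul (abs_nonneg s)]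
  congr 1
  ring

/-- `|s|^p = |s|^{p−1}·|s|` (`p ≠ 0`). [folklore] -/
theorem abs_rpow_eq_mul (s : ℝ) {p : ℝ} (hp : p ≠ 0) : |s| ^ p = |s| ^ (p - 1) * |s| := by
  have h := Real.rpow_add' (abs_nonneg s) (show p - 1 + 1 ≠ 0 by rw [sub_add_cancel]; exact hp)
  rw [sub_add_cancel, Real.rpow_one] at h
  exact h

/-- On `|s| ≤ S`, `|s|^p ≤ S^{p−1}|s|` (`p ≥ 1`). [folklore] -/
theorem abs_rpow_le_linear {s S p : ℝ} (hp : 1 ≤ p) (hs : |s| ≤ S) : |s| ^ p ≤ S ^ (p - 1) * |s| := by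
  rw [abs_rpow_eq_mul s (by linarith : p ≠ 0)]
  exact mul_le_mul_of_nonneg_right (Real.rpow_le_rpow (abs_nonneg s) hs (by linarith)) (abs_nonneg s)

/-- `|s|^p = 0 ⇒ s = 0` (`p ≠ 0`). [folklore] -/
theorem eq_zero_of_abs_rpow_eq_zero {s p : ℝ} (hp : p ≠ 0) (h : |s| ^ p = 0) : s = 0 := by
  have h2 := (Real.rpow_eq_zero_iff_of_nonneg (abs_nonneg s)).1 h
  have _hp := hp
  exact abs_eq_zero.1 h2.1

/-! ### Derivatives, values at `0`, signs -/

/-- `Φ_δ′`: `d/ds[(s²+δ)^{p/2} − δ^{p/2}] = p s (s²+δ)^{p/2−1}` (`δ > 0`). [folklore] -/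
theorem hasDerivAt_powReg (p : ℝ) {δ : ℝ} (hδ : 0 < δ) (s : ℝ) :
    HasDerivAt (fun x : ℝ => (x ^ 2 + δ) ^ (p / 2) - δ ^ (p / 2)) (p * s * (s ^ 2 + δ) ^ (p / 2 - 1)) s := by
  have h0 : HasDerivAt (fun x : ℝ => x ^ 2 + δ) (2 * s) s := by
    simpa using (hasDerivAt_pow 2 s).add_const δ
  have hpos : s ^ 2 + δ ≠ 0 := ne_of_gt (by positivity)
  have h1 := (h0.rpow_const (p := p / 2) (Or.inl hpos)).sub_const (δ ^ (p / 2))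
  refine h1.congr_deriv ?_
  ring

/-- `Φ_δ″`: `d/ds[p s (s²+δ)^{p/2−1}] = p (s²+δ)^{p/2−2}((p−1)s² + δ)` (`δ > 0`). [folklore] -/
theorem hasDerivAt_dPowReg (p : ℝ) {δ : ℝ} (hδ : 0 < δ) (s : ℝ) :
    HasDerivAt (fun x : ℝ => p * x * (x ^ 2 + δ) ^ (p / 2 - 1))
      (p * (s ^ 2 + δ) ^ (p / 2 - 2) * ((p - 1) * s ^ 2 + δ)) s := by
  have h0 : HasDerivAt (fun x : ℝ => x ^ 2 + δ) (2 * s) s := by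
    simpa using (hasDerivAt_pow 2 s).add_const δ
  have hpos' : 0 < s ^ 2 + δ := by positivity
  have hpos : s ^ 2 + δ ≠ 0 := ne_of_gt hpos'
  have h1 : HasDerivAt (fun x : ℝ => (x ^ 2 + δ) ^ (p / 2 - 1)) (2 * s * (p / 2 - 1) * (s ^ 2 + δ) ^ (p / 2 - 1 - 1)) s :=
    h0.rpow_const (p := p / 2 - 1) (Or.inl hpos)
  have h2 : HasDerivAt (fun x : ℝ => p * x) (p * 1) s := (hasDerivAt_id' s).const_mul p
  have h3 := h2.mul h1
  refine h3.congr_deriv ?_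
  have e1 : (s ^ 2 + δ) ^ (p / 2 - 1) = (s ^ 2 + δ) ^ (p / 2 - 2) * (s ^ 2 + δ) := by
    rw [show p / 2 - 1 = p / 2 - 2 + 1 by ring, Real.rpow_add_one hpos]
  have e2 : (s ^ 2 + δ) ^ (p / 2 - 1 - 1) = (s ^ 2 + δ) ^ (p / 2 - 2) := by
    rw [show p / 2 - 1 - 1 = p / 2 - 2 by ring]
  rw [e1, e2]
  ring

/-- `Φ_δ″` is continuous (`δ > 0`). [folklore] -/
theorem continuous_ddPowReg (p : ℝ) {δ : ℝ} (hδ : 0 < δ) :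
    Continuous fun s : ℝ => p * (s ^ 2 + δ) ^ (p / 2 - 2) * ((p - 1) * s ^ 2 + δ) := by
  have hb : Continuous fun s : ℝ => s ^ 2 + δ := (continuous_pow 2).add continuous_const
  have hr : Continuous fun s : ℝ => (s ^ 2 + δ) ^ (p / 2 - 2) :=
    hb.rpow_const fun s => Or.inl (ne_of_gt (by positivity))
  exact (continuous_const.mul hr).mul ((continuous_const.mul (continuous_pow 2)).add continuous_const)

/-- `Φ_δ(0) = 0`. [folklore] -/
theorem powReg_zero (p δ : ℝ) : ((0:ℝ) ^ 2 + δ) ^ (p / 2) - δ ^ (p / 2) = 0 := by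
  simp

/-- `Φ_δ′(0) = 0`. [folklore] -/
theorem dPowReg_zero (p δ : ℝ) : p * (0:ℝ) * ((0:ℝ) ^ 2 + δ) ^ (p / 2 - 1) = 0 := by
  simp

/-- `Φ_δ ≥ 0` (`p ≥ 0`, `δ ≥ 0`). [folklore] -/
theorem powReg_nonneg {p δ : ℝ} (hp : 0 ≤ p) (hδ : 0 ≤ δ) (s : ℝ) : 0 ≤ (s ^ 2 + δ) ^ (p / 2) - δ ^ (p / 2) :=
  sub_nonneg.2 (Real.rpow_le_rpow hδ (le_add_of_nonneg_left (sq_nonneg s)) (by linarith))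

/-- `sΦ_δ′(s) = p s²(s²+δ)^{p/2−1} ≥ 0` (`p ≥ 0`, `δ ≥ 0`). [folklore] -/
theorem mul_dPowReg_nonneg {p δ : ℝ} (hp : 0 ≤ p) (hδ : 0 ≤ δ) (s : ℝ) :
    0 ≤ s * (p * s * (s ^ 2 + δ) ^ (p / 2 - 1)) := by
  have h : 0 ≤ (s ^ 2 + δ) ^ (p / 2 - 1) := Real.rpow_nonneg (by positivity) _
  have : s * (p * s * (s ^ 2 + δ) ^ (p / 2 - 1)) = p * s ^ 2 * (s ^ 2 + δ) ^ (p / 2 - 1) := by ring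
  rw [this]
  positivity

/-- `Φ_δ″ ≥ 0` for `p ≥ 1`, `δ > 0` (convexity of the regularised power). [folklore] -/
theorem ddPowReg_nonneg {p δ : ℝ} (hp : 1 ≤ p) (hδ : 0 < δ) (s : ℝ) :
    0 ≤ p * (s ^ 2 + δ) ^ (p / 2 - 2) * ((p - 1) * s ^ 2 + δ) := by
  have h1 : 0 ≤ (s ^ 2 + δ) ^ (p / 2 - 2) := Real.rpow_nonneg (by positivity) _
  have h2 : 0 ≤ (p - 1) * s ^ 2 + δ := by nlinarith [sq_nonneg s]
  have h0 : 0 ≤ p := by linarith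
  positivity

/-! ### `δ`-uniform linear bounds on a bounded range -/

/-- **`Φ_δ(s) ≤ K|s|` uniformly in `0 < δ ≤ 1` on `|s| ≤ S`** (`p ≥ 1`): for `p ≥ 2` by the mean value theorem
(`Φ_δ(s) = (p/2)c^{p/2−1}s²`, `c ≤ S²+1`), for `1 ≤ p < 2` by subadditivity `(s²+δ)^{p/2} ≤ |s|^p + δ^{p/2}`. [folklore] -/
theorem powReg_le_linear {p S : ℝ} (hp : 1 ≤ p) (hS : 0 ≤ S) :
    ∃ K : ℝ, 0 ≤ K ∧ ∀ δ : ℝ, 0 < δ → δ ≤ 1 → ∀ s : ℝ, |s| ≤ S →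
      (s ^ 2 + δ) ^ (p / 2) - δ ^ (p / 2) ≤ K * |s| := by
  by_cases hp2 : 2 ≤ p
  · -- mean value theorem
    refine ⟨p / 2 * (S ^ 2 + 1) ^ (p / 2 - 1) * S, by positivity, fun δ hδ hδ1 s hs => ?_⟩
    have hs2 : s ^ 2 ≤ S * |s| := by
      rw [← sq_abs]; nlinarith [abs_nonneg s]
    by_cases hs0 : s = 0
    · subst hs0; simp
    have hsq : 0 < s ^ 2 := by positivity
    have hlt : δ < s ^ 2 + δ := by linarith
    obtain ⟨c, hc, hcd⟩ := exists_hasDerivAt_eq_slope (fun x : ℝ => x ^ (p / 2)) (fun x => p / 2 * x ^ (p / 2 - 1))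
      hlt ((Real.continuous_rpow_const (by linarith)).continuousOn)
      (fun x hx => Real.hasDerivAt_rpow_const (Or.inl (ne_of_gt (hδ.trans hx.1))))
    have hc0 : 0 ≤ c := le_of_lt (hδ.trans hc.1)
    have hcle : c ≤ S ^ 2 + 1 := by
      have : s ^ 2 ≤ S ^ 2 := by rw [← sq_abs]; exact pow_le_pow_left₀ (abs_nonneg s) hs 2
      linarith [hc.2]
    have hcpow : c ^ (p / 2 - 1) ≤ (S ^ 2 + 1) ^ (p / 2 - 1) := Real.rpow_le_rpow hc0 hcle (by linarith)
    have hden : s ^ 2 + δ - δ = s ^ 2 := by ring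
    rw [hden] at hcd
    have heq : (s ^ 2 + δ) ^ (p / 2) - δ ^ (p / 2) = p / 2 * c ^ (p / 2 - 1) * s ^ 2 := by
      rw [eq_div_iff (ne_of_gt hsq)] at hcd
      linarith
    rw [heq]
    have hp0 : 0 ≤ p / 2 := by linarith
    calc p / 2 * c ^ (p / 2 - 1) * s ^ 2 ≤ p / 2 * (S ^ 2 + 1) ^ (p / 2 - 1) * s ^ 2 := by gcongr
      _ ≤ p / 2 * (S ^ 2 + 1) ^ (p / 2 - 1) * (S * |s|) := by gcongr
      _ = p / 2 * (S ^ 2 + 1) ^ (p / 2 - 1) * S * |s| := by ring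
  · -- subadditivity
    have hp2' : p < 2 := lt_of_not_ge hp2
    refine ⟨S ^ (p - 1), Real.rpow_nonneg hS _, fun δ hδ _ s hs => ?_⟩
    have hsub : (s ^ 2 + δ) ^ (p / 2) ≤ (s ^ 2) ^ (p / 2) + δ ^ (p / 2) :=
      Real.rpow_add_le_add_rpow (sq_nonneg s) hδ.le (by linarith) (by linarith)
    rw [sq_rpow_half] at hsub
    have h3 := abs_rpow_le_linear hp hs
    linarith

/-- **`sΦ_δ′(s) ≤ K|s|` uniformly in `0 < δ ≤ 1` on `|s| ≤ S`** (`p ≥ 1`): for `p ≥ 2`, `(s²+δ)^{p/2−1} ≤ (S²+1)^{p/2−1}`; for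
`1 ≤ p < 2`, `(s²+δ)^{p/2−1} ≤ (s²)^{p/2−1}` so `sΦ_δ′(s) ≤ p|s|^p ≤ pS^{p−1}|s|`. [folklore] -/
theorem mul_dPowReg_le_linear {p S : ℝ} (hp : 1 ≤ p) (hS : 0 ≤ S) :
    ∃ K : ℝ, 0 ≤ K ∧ ∀ δ : ℝ, 0 < δ → δ ≤ 1 → ∀ s : ℝ, |s| ≤ S →
      s * (p * s * (s ^ 2 + δ) ^ (p / 2 - 1)) ≤ K * |s| := by
  have hp0 : 0 ≤ p := by linarith
  by_cases hp2 : 2 ≤ p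
  · refine ⟨p * (S ^ 2 + 1) ^ (p / 2 - 1) * S, by positivity, fun δ hδ hδ1 s hs => ?_⟩
    have hs2 : s ^ 2 ≤ S * |s| := by
      rw [← sq_abs]; nlinarith [abs_nonneg s]
    have hb : s ^ 2 + δ ≤ S ^ 2 + 1 := by
      have : s ^ 2 ≤ S ^ 2 := by rw [← sq_abs]; exact pow_le_pow_left₀ (abs_nonneg s) hs 2
      linarith
    have hpow : (s ^ 2 + δ) ^ (p / 2 - 1) ≤ (S ^ 2 + 1) ^ (p / 2 - 1) :=
      Real.rpow_le_rpow (by positivity) hb (by linarith)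
    have hnn : 0 ≤ (s ^ 2 + δ) ^ (p / 2 - 1) := Real.rpow_nonneg (by positivity) _
    calc s * (p * s * (s ^ 2 + δ) ^ (p / 2 - 1)) = p * (s ^ 2 + δ) ^ (p / 2 - 1) * s ^ 2 := by ring
      _ ≤ p * (S ^ 2 + 1) ^ (p / 2 - 1) * (S * |s|) := by gcongr
      _ = p * (S ^ 2 + 1) ^ (p / 2 - 1) * S * |s| := by ring
  · have hp2' : p < 2 := lt_of_not_ge hp2
    refine ⟨p * S ^ (p - 1), mul_nonneg hp0 (Real.rpow_nonneg hS _), fun δ hδ _ s hs => ?_⟩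
    by_cases hs0 : s = 0
    · subst hs0; simp
    have hsq : 0 < s ^ 2 := by positivity
    have hanti : (s ^ 2 + δ) ^ (p / 2 - 1) ≤ (s ^ 2) ^ (p / 2 - 1) :=
      Real.rpow_le_rpow_of_nonpos hsq (by linarith) (by linarith)
    have hpow : s ^ 2 * (s ^ 2) ^ (p / 2 - 1) = |s| ^ p := by
      rw [← sq_rpow_half, show p / 2 = p / 2 - 1 + 1 by ring, Real.rpow_add_one (ne_of_gt hsq)]
      ring_nf
    have h3 := abs_rpow_le_linear hp hs
    calc s * (p * s * (s ^ 2 + δ) ^ (p / 2 - 1)) = p * (s ^ 2 * (s ^ 2 + δ) ^ (p / 2 - 1)) := by ring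
      _ ≤ p * (s ^ 2 * (s ^ 2) ^ (p / 2 - 1)) := by gcongr
      _ = p * |s| ^ p := by rw [hpow]
      _ ≤ p * (S ^ (p - 1) * |s|) := by gcongr
      _ = p * S ^ (p - 1) * |s| := by ring

/-- For FIXED `δ > 0`: `|Φ_δ′(s)| ≤ K_δ |s|` on `|s| ≤ S` (used for the boundary term `Ω′Φ_δ′(Ω) → 0`). [folklore] -/
theorem abs_dPowReg_le_linear (p : ℝ) {δ S : ℝ} (hδ : 0 < δ) (hS : 0 ≤ S) :
    ∃ K : ℝ, 0 ≤ K ∧ ∀ s : ℝ, |s| ≤ S → |p * s * (s ^ 2 + δ) ^ (p / 2 - 1)| ≤ K * |s| := by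
  -- the continuous factor `(s²+δ)^{p/2−1}` is bounded on `[-S, S]`
  have hb : Continuous fun s : ℝ => s ^ 2 + δ := (continuous_pow 2).add continuous_const
  have hc : Continuous fun s : ℝ => (s ^ 2 + δ) ^ (p / 2 - 1) :=
    hb.rpow_const fun s => Or.inl (ne_of_gt (by positivity))
  obtain ⟨B, hB⟩ := isCompact_Icc.exists_bound_of_continuousOn (hc.continuousOn (s := Icc (-S) S))
  have hB0 : 0 ≤ B := (norm_nonneg _).trans (hB 0 ⟨by linarith, hS⟩)
  refine ⟨|p| * B, mul_nonneg (abs_nonneg p) hB0, fun s hs => ?_⟩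
  have hsI : s ∈ Icc (-S) S := ⟨by linarith [abs_le.1 hs |>.1], (abs_le.1 hs).2⟩
  have hb := hB s hsI
  rw [Real.norm_eq_abs] at hb
  rw [abs_mul, abs_mul]
  calc |p| * |s| * |(s ^ 2 + δ) ^ (p / 2 - 1)| ≤ |p| * |s| * B := by gcongr
    _ = |p| * B * |s| := by ring

/-! ### The limits `δ → 0⁺` -/

/-- `Φ_δ(s) → |s|^p` as `δ → 0⁺` (`p > 0`). [folklore] -/
theorem tendsto_powReg {p : ℝ} (hp : 0 < p) (s : ℝ) :
    Tendsto (fun δ : ℝ => (s ^ 2 + δ) ^ (p / 2) - δ ^ (p / 2)) (𝓝[>] 0) (𝓝 (|s| ^ p)) := by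
  have hδ : Tendsto (fun δ : ℝ => δ) (𝓝[>] (0:ℝ)) (𝓝 0) := tendsto_id.mono_left nhdsWithin_le_nhds
  have h1 : Tendsto (fun δ : ℝ => s ^ 2 + δ) (𝓝[>] (0:ℝ)) (𝓝 (s ^ 2)) := by
    simpa using tendsto_const_nhds.add hδ
  have h2 : Tendsto (fun δ : ℝ => (s ^ 2 + δ) ^ (p / 2)) (𝓝[>] (0:ℝ)) (𝓝 ((s ^ 2) ^ (p / 2))) :=
    h1.rpow_const (Or.inr (by linarith))
  have h3 : Tendsto (fun δ : ℝ => δ ^ (p / 2)) (𝓝[>] (0:ℝ)) (𝓝 0) := hδ.rpow_const_nhds_zero (by linarith)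
  have h := h2.sub h3
  rw [sq_rpow_half, sub_zero] at h
  exact h

/-- `sΦ_δ′(s) → p|s|^p` as `δ → 0⁺` (`p > 0`). [folklore] -/
theorem tendsto_mul_dPowReg {p : ℝ} (hp : 0 < p) (s : ℝ) :
    Tendsto (fun δ : ℝ => s * (p * s * (s ^ 2 + δ) ^ (p / 2 - 1))) (𝓝[>] 0) (𝓝 (p * |s| ^ p)) := by
  by_cases hs0 : s = 0
  · subst hs0
    simp only [zero_mul, mul_zero, abs_zero, Real.zero_rpow hp.ne']
    exact tendsto_const_nhds
  have hsq : 0 < s ^ 2 := by positivity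
  have hδ : Tendsto (fun δ : ℝ => δ) (𝓝[>] (0:ℝ)) (𝓝 0) := tendsto_id.mono_left nhdsWithin_le_nhds
  have h1 : Tendsto (fun δ : ℝ => s ^ 2 + δ) (𝓝[>] (0:ℝ)) (𝓝 (s ^ 2)) := by
    simpa using tendsto_const_nhds.add hδ
  have h2 : Tendsto (fun δ : ℝ => (s ^ 2 + δ) ^ (p / 2 - 1)) (𝓝[>] (0:ℝ)) (𝓝 ((s ^ 2) ^ (p / 2 - 1))) :=
    h1.rpow_const (Or.inl (ne_of_gt hsq))
  have h3 := h2.const_mul (p * s ^ 2)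
  have hlim : p * s ^ 2 * (s ^ 2) ^ (p / 2 - 1) = p * |s| ^ p := by
    rw [← sq_rpow_half, show p / 2 = p / 2 - 1 + 1 by ring, Real.rpow_add_one (ne_of_gt hsq)]
    ring_nf
  rw [hlim] at h3
  refine h3.congr fun δ => ?_
  ring

end SheetHalfLine
end Summit.NavierStokesRegularity.OSWSelfSimilar
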